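import Summits.QuantumFields.YangMills.Theorems.UnitScaleTiltProp8ChartHInvGeometry
import Literature.MathematicalPhysics.QuantumFieldTheory.BalabanImbrieJaffe1984to88.BIJ88BlockCentredWeight
import HarnessLib

/-!
# Route `UnitScaleTilt`, crux K1 «MinimiserStabilityRegPr» (stmt-QuantumFields-19200), leaf V2′ — the P2→P3 BRIDGE (hH of `ChartRemainderAt`),
# part B2: **TENTS ON THE `j`-FOLD BLOCKS AND THE TERRITORY COLLAR OF (2.2)**

Cell `ym3-torus`, seat `ym3-torus-p1` g18.  (§3) For every `j ≤ m + K` and `y ∈ T^{(j)}` a TENT `τ : T_η → [0,1]` with `τ(embIter j y) = 1`, supported in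
`B^j(y)`, and `|τ(b₊) − τ(b₋)| ≤ 2/L^j` on every fine bond — the product over the coordinates of the one-dimensional tents `1 − (2/(L^j+1))|o − (L^j−1)/2|` in the
in-block labels `o` (across a face of `B^j(y)` the inner value is already `2/(L^j+1)`); these spread the pinned values of the comb functional in the gauge part `dφ`
of the bridge (part C) at slope `2/L^j`.  (§4) Under (2.2)-admissibility `Adm22 D R M` with `R·M ≥ 1`, the `j`-blocks of the two end-points of a fine bond are
within sup-distance `1`, so if one end-point lies in `Ω_{i+1}` the other lies in `Ω_i`: the territory levels of the two end-points differ by at most one.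
Theorems only; nothing of Bałaban's asserted.  NOT a claim about the mass gap.

References: T. Bałaban, CMP **96** (1984) 223–250 [Balaban1984PropagatorsII] ((2.1)–(2.4) p.224, (2.147) p.248); CMP **109** (1987) 249–301 [Balaban1987RG1]
((0.1) pp.251–252).
-/

noncomputable section

open scoped BigOperators

namespace Summit.QuantumFields.YangMills.Theorems.ChartHInv

open Literature.MathematicalPhysics.QuantumFieldTheory.Balaban1983to89
open T4Continuum BlockAveraging BlockAveragingEMLLinearised LatticeFieldCalculus
open B5Eq118OneStroke (iterBlockOf iterBlockOf_zero iterBlockOf_succ val_iterBlockOf)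
open B15DeterminingSets (embIter)
open Literature.MathematicalPhysics.QuantumFieldTheory.BalabanImbrieJaffe1984to88.BIJ88RT51Background (iterBlockOf_embIter)
open Literature.MathematicalPhysics.QuantumFieldTheory.BalabanImbrieJaffe1984to88 (BIJ88BlockCentredWeight.pow_dvd_sitesPerDir)
open B5Prop12FieldsLattice (distSite)
open B5Eq117TorusCarriers (Mk)
open B6SectADomainsV1 (Domains)
open B11Eq115Space (levOf)
open BlockAveragingHaarAC (exists_take_of_mem_walk)
open Literature.MathematicalPhysics.QuantumFieldTheory.BalabanImbrieJaffe1984to88.BIJ85GaugeFunction5113 (blk)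
open Literature.MathematicalPhysics.QuantumFieldTheory.BalabanImbrieJaffe1984to88.BIJ85ContourLocality (norm_bondAvgIter_le_tower)
open Summit.QuantumFields.YangMills.Theorems.Prop8Chart (norm_walkSum_le_of_steps norm_card_inv_smul_sum_le)

variable {P : Params} {n : Type*}

/-! ## §3 Tents -/

section Tent

/-- The one-dimensional tent on the labels `0, …, N − 1` of a block of odd side `N = 2c + 1`: `f(o) = 1 − (2/(N+1))·|o − c|` takes values in `[2/(N+1), 1]`.
[folklore] -/
theorem tent1_bounds {N c o : ℕ} (hN : N = 2 * c + 1) (ho : o < N) :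
    2 / ((N : ℝ) + 1) ≤ 1 - 2 / ((N : ℝ) + 1) * |(o : ℝ) - c| ∧ 1 - 2 / ((N : ℝ) + 1) * |(o : ℝ) - c| ≤ 1 := by
  have hN1 : (0 : ℝ) < (N : ℝ) + 1 := by positivity
  have habs : |(o : ℝ) - c| ≤ c := by
    rw [abs_le]; constructor
    · have : (0 : ℝ) ≤ o := Nat.cast_nonneg o; linarith
    · have : (o : ℝ) ≤ 2 * c := by exact_mod_cast (by omega : o ≤ 2 * c)
      linarith
  constructor
  · have hNc : (N : ℝ) + 1 = 2 * c + 2 := by rw [hN]; push_cast; ring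
    rw [hNc] at hN1 ⊢
    have h2 : 2 / (2 * (c : ℝ) + 2) * |(o : ℝ) - c| ≤ 2 / (2 * (c : ℝ) + 2) * c := mul_le_mul_of_nonneg_left habs (by positivity)
    have h3 : 2 / (2 * (c : ℝ) + 2) + 2 / (2 * (c : ℝ) + 2) * c = 1 := by field_simp; ring
    linarith
  · have : 0 ≤ 2 / ((N : ℝ) + 1) * |(o : ℝ) - c| := by positivity
    linarith

/-- The one-dimensional tent is `1` at the centre. [folklore] -/
theorem tent1_centre {N c : ℕ} : 1 - 2 / ((N : ℝ) + 1) * |((c : ℕ) : ℝ) - c| = 1 := by simp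

/-- The one-dimensional tent is `2/(N+1)` at the two ends `o = 0`, `o = N − 1`. [folklore] -/
theorem tent1_ends {N c : ℕ} (hN : N = 2 * c + 1) :
    1 - 2 / ((N : ℝ) + 1) * |((0 : ℕ) : ℝ) - c| = 2 / ((N : ℝ) + 1) ∧ 1 - 2 / ((N : ℝ) + 1) * |((N - 1 : ℕ) : ℝ) - c| = 2 / ((N : ℝ) + 1) := by
  have hNc : (N : ℝ) + 1 = 2 * c + 2 := by rw [hN]; push_cast; ring
  have hN1 : (N - 1 : ℕ) = 2 * c := by omega
  have hc : (0 : ℝ) ≤ c := Nat.cast_nonneg c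
  rw [hNc, hN1]
  push_cast
  rw [zero_sub, abs_neg, abs_of_nonneg hc, show (2 : ℝ) * c - c = c by ring, abs_of_nonneg hc]
  constructor <;> · field_simp; ring

/-- The one-dimensional tent is `2/(N+1)`-Lipschitz in the label. [folklore] -/
theorem tent1_lip {N c o : ℕ} :
    |(1 - 2 / ((N : ℝ) + 1) * |((o + 1 : ℕ) : ℝ) - c|) - (1 - 2 / ((N : ℝ) + 1) * |(o : ℝ) - c|)| ≤ 2 / ((N : ℝ) + 1) := by
  have hN1 : (0 : ℝ) ≤ 2 / ((N : ℝ) + 1) := by positivity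
  rw [show (1 - 2 / ((N : ℝ) + 1) * |((o + 1 : ℕ) : ℝ) - c|) - (1 - 2 / ((N : ℝ) + 1) * |(o : ℝ) - c|) =
    2 / ((N : ℝ) + 1) * (|(o : ℝ) - c| - |((o + 1 : ℕ) : ℝ) - c|) by ring, abs_mul, abs_of_nonneg hN1]
  refine mul_le_of_le_one_right hN1 ?_
  have := abs_abs_sub_abs_le_abs_sub ((o : ℝ) - c) (((o + 1 : ℕ) : ℝ) - c)
  push_cast at this ⊢
  rw [show (o : ℝ) - c - ((o : ℝ) + 1 - c) = -1 by ring, abs_neg, abs_one] at this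
  exact this

/-- A product of factors in `[0, 1]` lies in `[0, 1]`. [folklore] -/
theorem prod_mem_unit {ι : Type*} (s : Finset ι) (g : ι → ℝ) (h : ∀ i ∈ s, 0 ≤ g i ∧ g i ≤ 1) :
    0 ≤ ∏ i ∈ s, g i ∧ ∏ i ∈ s, g i ≤ 1 :=
  ⟨Finset.prod_nonneg fun i hi => (h i hi).1, Finset.prod_le_one (fun i hi => (h i hi).1) fun i hi => (h i hi).2⟩

/-- A product of factors in `[0, 1]` is below each factor. [folklore] -/
theorem prod_le_factor {ι : Type*} [DecidableEq ι] (s : Finset ι) (g : ι → ℝ) (h : ∀ i ∈ s, 0 ≤ g i ∧ g i ≤ 1) {ν : ι} (hν : ν ∈ s) :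
    ∏ i ∈ s, g i ≤ g ν := by
  rw [← Finset.mul_prod_erase s g hν]
  have h1 := prod_mem_unit (s.erase ν) g fun i hi => h i (Finset.mem_of_mem_erase hi)
  exact mul_le_of_le_one_right (h ν hν).1 h1.2

/-- Two products of factors in `[0, 1]` differing in one factor differ by at most the difference of that factor. [folklore] -/
theorem abs_prod_sub_prod_le {ι : Type*} [DecidableEq ι] (s : Finset ι) (g g' : ι → ℝ) (h : ∀ i ∈ s, 0 ≤ g i ∧ g i ≤ 1) {ν : ι} (hν : ν ∈ s)
    (hg : ∀ i ∈ s, i ≠ ν → g' i = g i) : |∏ i ∈ s, g' i - ∏ i ∈ s, g i| ≤ |g' ν - g ν| := by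
  rw [← Finset.mul_prod_erase s g hν, ← Finset.mul_prod_erase s g' hν]
  have heq : ∏ i ∈ s.erase ν, g' i = ∏ i ∈ s.erase ν, g i :=
    Finset.prod_congr rfl fun i hi => hg i (Finset.mem_of_mem_erase hi) (Finset.ne_of_mem_erase hi)
  rw [heq, ← sub_mul, abs_mul]
  have h1 := prod_mem_unit (s.erase ν) g fun i hi => h i (Finset.mem_of_mem_erase hi)
  rw [abs_of_nonneg h1.1]
  exact mul_le_of_le_one_right (abs_nonneg _) h1.2

/-- Labels of a shifted site: in the shift direction `(x + e_ν)_ν ≡ x_ν + 1`, read modulo `L^j` (`L^j` divides the torus size). [cite: Balaban1987RG1, (0.1) p.251] -/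
theorem val_shift_mod_pow {j : ℕ} (hj : j ≤ P.m + P.K) (x : Site P 0) (ν : Fin P.d) :
    ((x.shift ν) ν).val % P.L ^ j = ((x ν).val % P.L ^ j + 1) % P.L ^ j := by
  have hval : ((x.shift ν) ν).val = ((x ν).val + 1) % P.sitesPerDir 0 := by
    simp only [Site.shift, Function.update_self]
    rw [ZMod.val_add, ZMod.val_one]
  rw [hval, Nat.mod_mod_of_dvd _ (BIJ88BlockCentredWeight.pow_dvd_sitesPerDir hj), Nat.add_mod, Nat.add_mod ((x ν).val % P.L ^ j) 1, Nat.mod_mod]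

end Tent

/-- **TENTS**: for every `j ≤ m + K` and `y ∈ T^{(j)}` there is `τ : T_η → [0, 1]` with `τ(embIter j y) = 1`, `τ = 0` off `B^j(y)`, and
`|τ(b₊) − τ(b₋)| ≤ 2/L^j` on every fine bond (the product over the coordinates of the one-dimensional tents in the in-block labels; across a face of
`B^j(y)` the inner value is already `≤ 2/(L^j+1)`). [cite: Balaban1984PropagatorsII, (2.147) p.248] -/
theorem exists_tent {j : ℕ} (hj : j ≤ P.m + P.K) (y : Site P j) :
    ∃ τ : Site P 0 → ℝ, τ (embIter j y) = 1 ∧ (∀ x, iterBlockOf j x ≠ y → τ x = 0) ∧ (∀ x, 0 ≤ τ x ∧ τ x ≤ 1) ∧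
      ∀ b : PBond P 0, |τ b.tgt - τ b.src| ≤ 2 / (P.L : ℝ) ^ j := by
  classical
  obtain ⟨c', hc'⟩ : Odd (P.L ^ j) := P.hL.1.pow
  set N : ℕ := P.L ^ j with hN
  set c : ℕ := (N - 1) / 2 with hc
  have hNodd : N = 2 * c + 1 := by omega
  have hNpos : 0 < N := by omega
  have hN1 : (0 : ℝ) < (N : ℝ) + 1 := by positivity
  -- the one-dimensional tent `f` and the product tent `g`
  obtain ⟨f, hf⟩ : ∃ f : ℕ → ℝ, ∀ o, f o = 1 - 2 / ((N : ℝ) + 1) * |(o : ℝ) - c| := ⟨_, fun _ => rfl⟩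
  have hf01 : ∀ o, o < N → 0 ≤ f o ∧ f o ≤ 1 := fun o ho => by
    have h := tent1_bounds hNodd ho
    rw [hf]; exact ⟨le_trans (by positivity) h.1, h.2⟩
  have hmodlt : ∀ (x : Site P 0) (μ : Fin P.d), (x μ).val % N < N := fun x μ => Nat.mod_lt _ hNpos
  obtain ⟨g, hg⟩ : ∃ g : Site P 0 → ℝ, ∀ x, g x = ∏ μ : Fin P.d, f ((x μ).val % N) := ⟨_, fun _ => rfl⟩
  have hg01 : ∀ x, 0 ≤ g x ∧ g x ≤ 1 := fun x => by
    rw [hg]; exact prod_mem_unit _ _ fun μ _ => hf01 _ (hmodlt x μ)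
  have hgle : ∀ (x : Site P 0) (ν : Fin P.d), g x ≤ f ((x ν).val % N) := fun x ν => by
    rw [hg]; exact prod_le_factor _ _ (fun μ _ => hf01 _ (hmodlt x μ)) (Finset.mem_univ ν)
  have hends : f 0 = 2 / ((N : ℝ) + 1) ∧ f (N - 1) = 2 / ((N : ℝ) + 1) := by
    have h := tent1_ends hNodd
    rw [hf, hf]; exact_mod_cast h
  obtain ⟨τ, hτ⟩ : ∃ τ : Site P 0 → ℝ, ∀ x, τ x = if iterBlockOf j x = y then g x else 0 := ⟨_, fun _ => rfl⟩
  refine ⟨τ, ?_, ?_, ?_, ?_⟩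
  · -- the centre
    rw [hτ, if_pos (iterBlockOf_embIter j hj y), hg]
    refine Finset.prod_eq_one fun μ _ => ?_
    rw [val_embIter_mod hj, ← hN, ← hc, hf]
    simp
  · intro x hx
    rw [hτ, if_neg hx]
  · intro x
    by_cases hx : iterBlockOf j x = y
    · rw [hτ, if_pos hx]; exact hg01 x
    · rw [hτ, if_neg hx]; exact ⟨le_rfl, zero_le_one⟩
  · intro b
    rw [hτ, hτ]
    have hfinal : 2 / ((N : ℝ) + 1) ≤ 2 / (P.L : ℝ) ^ j := by
      rw [show (P.L : ℝ) ^ j = (N : ℝ) by rw [hN]; push_cast; rfl]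
      exact div_le_div_of_nonneg_left (by norm_num) (by exact_mod_cast hNpos) (by linarith)
    refine le_trans ?_ hfinal
    set x := b.src with hx
    set ν := b.dir with hν
    have htgt : b.tgt = x.shift ν := rfl
    have hother : ∀ μ, μ ≠ ν → (b.tgt μ).val % N = (x μ).val % N := fun μ hμ => by
      rw [htgt]; simp [Site.shift, Function.update_of_ne hμ]
    have hshift : (b.tgt ν).val % N = ((x ν).val % N + 1) % N := by rw [htgt]; exact val_shift_mod_pow hj x ν
    by_cases hcase : (x ν).val % N + 1 < N
    · -- interior step: same block, one label moves by one
      rw [Nat.mod_eq_of_lt hcase] at hshift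
      have hval : (b.tgt ν).val = (x ν).val + 1 := by
        have hlt : (x ν).val + 1 < P.sitesPerDir 0 := by
          have hle : (x ν).val + 1 ≤ P.sitesPerDir 0 := ZMod.val_lt (x ν)
          rcases hle.lt_or_eq with h | h
          · exact h
          · exfalso
            obtain ⟨q, hq⟩ := BIJ88BlockCentredWeight.pow_dvd_sitesPerDir (P := P) hj
            have hq1 : 1 ≤ q := by
              rcases Nat.eq_zero_or_pos q with h0 | h0
              · rw [h0, mul_zero] at hq; exact absurd hq (P.sitesPerDir_ne_zero 0)
              · exact h0
            have hxv : (x ν).val = N * (q - 1) + (N - 1) := by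
              have : (x ν).val + 1 = N * q := by rw [h, hq]
              have : N * q = N * (q - 1) + N := by
                rw [← Nat.mul_succ, Nat.succ_eq_add_one, Nat.sub_add_cancel hq1]
              omega
            have : (x ν).val % N = N - 1 := by rw [hxv, Nat.mul_add_mod, Nat.mod_eq_of_lt (by omega)]
            omega
        rw [htgt]
        simp only [Site.shift, Function.update_self]
        rw [ZMod.val_add, ZMod.val_one, Nat.mod_eq_of_lt hlt]
      have hsame : iterBlockOf j b.tgt = iterBlockOf j x := by
        funext μ
        apply ZMod.val_injective
        rw [val_iterBlockOf j hj, val_iterBlockOf j hj]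
        by_cases hμ : μ = ν
        · subst hμ
          rw [hval]
          have hdm := Nat.div_add_mod (x ν).val N
          conv_lhs => rw [← hdm, Nat.add_assoc, Nat.mul_add_div hNpos, Nat.div_eq_of_lt hcase]
          rw [add_zero]
        · rw [htgt]; simp [Site.shift, Function.update_of_ne hμ]
      by_cases hin : iterBlockOf j x = y
      · rw [if_pos hin, if_pos (hsame.trans hin), hg, hg]
        refine (abs_prod_sub_prod_le _ _ _ (fun μ _ => hf01 _ (hmodlt x μ)) (Finset.mem_univ ν) fun μ _ hμ => by rw [hother μ hμ]).trans ?_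
        rw [hshift, hf, hf]
        exact tent1_lip
      · have hout : iterBlockOf j b.tgt ≠ y := fun h => hin (hsame.symm.trans h)
        rw [if_neg hin, if_neg hout, sub_zero, abs_zero]
        positivity
    · -- a step across a face of the `L^j`-blocks: both values are already small
      have heq : (x ν).val % N + 1 = N := by have := hmodlt x ν; omega
      have hsrc_small : (if iterBlockOf j x = y then g x else 0) ≤ 2 / ((N : ℝ) + 1) := by
        split_ifs
        · refine (hgle x ν).trans ?_
          rw [show (x ν).val % N = N - 1 by omega, hends.2]
        · positivity
      have htgt_small : (if iterBlockOf j b.tgt = y then g b.tgt else 0) ≤ 2 / ((N : ℝ) + 1) := by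
        split_ifs
        · refine (hgle b.tgt ν).trans ?_
          rw [hshift, heq, Nat.mod_self, hends.1]
        · positivity
      have hsrc0 : 0 ≤ (if iterBlockOf j x = y then g x else 0) := by split_ifs; exacts [(hg01 x).1, le_rfl]
      have htgt0 : 0 ≤ (if iterBlockOf j b.tgt = y then g b.tgt else 0) := by split_ifs; exacts [(hg01 _).1, le_rfl]
      rw [abs_sub_le_iff]
      constructor <;> linarith

/-! ## §4 Blocks of adjacent fine sites; the territory collar of (2.2) -/

/-- The `j`-blocks of the two end-points of a fine bond are within sup-distance `1` (`L^j·dist_j ≤ dist₀ + L^j − 1`, `dist₀ ≤ 1`).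
[cite: Balaban1984PropagatorsII, (2.2) p.224] -/
theorem distSite_iterBlockOf_endpoints_le_one {j : ℕ} (hj : j ≤ P.m + P.K) (b : PBond P 0) :
    distSite (Mk P j) (iterBlockOf j b.src) (iterBlockOf j b.tgt) ≤ 1 := by
  have h1 := FlatPortChart.pow_mul_distSite_iterBlockOf_le j hj b.src b.tgt
  have h2 : distSite (Mk P 0) b.src b.tgt ≤ 1 := FlatCubeQContraction.distSite_shift_le_one b.src b.dir
  have hLj : (0 : ℝ) < (P.L : ℝ) ^ j := by have := P.L_pos; positivity
  by_contra h
  rw [not_le] at h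
  have : (P.L : ℝ) ^ j * 1 < (P.L : ℝ) ^ j * distSite (Mk P j) (iterBlockOf j b.src) (iterBlockOf j b.tgt) := mul_lt_mul_of_pos_left h hLj
  linarith

open Summit.QuantumFields.YangMills.Theorems.FlatCubeOpsText (Adm22)

/-- **THE TERRITORY COLLAR OF (2.2)**: under `Adm22 D R M` with `R·M ≥ 1`, if one end-point of a fine bond lies in `Ω_{i+1}` the other lies in `Ω_i`
(`dist_i(Ω_{i+1}, Ω_iᶜ) > R·M ≥ 1` while the `i`-blocks of the two end-points are within distance `1`). [cite: Balaban1984PropagatorsII, (2.2) p.224] -/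
theorem inOm_of_inOm_succ_adjacent (D : Domains P) {R M : ℕ} (hAdm : Adm22 D R M) (hRM : 1 ≤ R * M) (b : PBond P 0) (i : ℕ) :
    (D.InOm (i + 1) b.src → D.InOm i b.tgt) ∧ (D.InOm (i + 1) b.tgt → D.InOm i b.src) := by
  have hRM' : (1 : ℝ) ≤ ((R * M : ℕ) : ℝ) := by exact_mod_cast hRM
  have hi_of : ∀ z : Site P 0, D.InOm (i + 1) z → i ≤ P.m + P.K := by
    intro z hz
    have : i + 1 ≤ D.k := by
      by_contra h
      have he := D.Om_eq_empty (j := i + 1) (by omega)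
      simp [Domains.InOm, he] at hz
    have := D.hk; omega
  constructor
  · intro hsrc
    by_contra htgt
    have hi := hi_of _ hsrc
    have hsep := hAdm.2 i (iterBlockOf i b.src) (iterBlockOf i b.tgt) (by simpa [Domains.InOm, iterBlockOf_succ] using hsrc) htgt
    have hd := distSite_iterBlockOf_endpoints_le_one hi b
    linarith
  · intro htgt
    by_contra hsrc
    have hi := hi_of _ htgt
    have hsep := hAdm.2 i (iterBlockOf i b.tgt) (iterBlockOf i b.src) (by simpa [Domains.InOm, iterBlockOf_succ] using htgt) hsrc
    have hd := distSite_iterBlockOf_endpoints_le_one hi b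
    rw [B5RowSumsP12Lattice.distSite_comm] at hd
    linarith

/-- **THE TERRITORY LEVELS OF THE TWO END-POINTS OF A FINE BOND DIFFER BY AT MOST ONE** under (2.2)-admissibility with `R·M ≥ 1`.
[cite: Balaban1984PropagatorsII, (2.2)-(2.4) p.224] -/
theorem levOf_endpoints_le_succ (D : Domains P) {R M : ℕ} (hAdm : Adm22 D R M) (hRM : 1 ≤ R * M) (b : PBond P 0) :
    levOf (fun i => {z : Site P 0 | D.InOm i z}) D.k b.src ≤ levOf (fun i => {z : Site P 0 | D.InOm i z}) D.k b.tgt + 1 ∧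
      levOf (fun i => {z : Site P 0 | D.InOm i z}) D.k b.tgt ≤ levOf (fun i => {z : Site P 0 | D.InOm i z}) D.k b.src + 1 := by
  set js := levOf (fun i => {z : Site P 0 | D.InOm i z}) D.k b.src with hjs
  set jt := levOf (fun i => {z : Site P 0 | D.InOm i z}) D.k b.tgt with hjt
  have hls := FlatCubeLevels.lamSite_levOf_inOm D b.src
  have hlt := FlatCubeLevels.lamSite_levOf_inOm D b.tgt
  rw [← hjs] at hls
  rw [← hjt] at hlt
  constructor
  · by_contra h
    rw [not_le] at h
    have hsrc : D.InOm (jt + 1 + 1) b.src := D.inOm_of_le (by omega) hls.1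
    have htgt : D.InOm (jt + 1) b.tgt := ((inOm_of_inOm_succ_adjacent D hAdm hRM b (jt + 1)).1 hsrc)
    exact hlt.2 ((D.deep_iterBlockOf_iff jt b.tgt).2 htgt)
  · by_contra h
    rw [not_le] at h
    have htgt : D.InOm (js + 1 + 1) b.tgt := D.inOm_of_le (by omega) hlt.1
    have hsrc : D.InOm (js + 1) b.src := ((inOm_of_inOm_succ_adjacent D hAdm hRM b (js + 1)).2 htgt)
    exact hls.2 ((D.deep_iterBlockOf_iff js b.src).2 hsrc)

end Summit.QuantumFields.YangMills.Theorems.ChartHInv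

end
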